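import Literature.NumberTheory.Transcendental.FormIntegrationStokes
import HarnessLib

/-!
# The integral of a top form supported in one oriented chart is the chart integral

Topic `Literature/Geometry/Manifold` (integration of top forms; complement to the tree's
integration theory `Literature/NumberTheory/Transcendental/FormIntegration*.lean`). On a closed
manifold `M` with an orientation family `o`, let the chart at `p` have constant sign `ε` on a set
`B` of its target and let `ψ : M → ℝ` be smooth with (compact) support in the chart source,
`extChartAt I p '' tsupport ψ ⊆ B`. Then for every smooth top form `β`
(`MForm.integral_smul_eq_mul_setIntegral_inChart`):

`∫_M ψ • β = ε · ∫_{y ∈ target} ψ (φ⁻¹ y) · β̂_p(y)(e₁, …, eₙ) dλ_e(y)`,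

the chart integral of the representative `β̂_p = β.inChart p` on the reference frame
`e = modelBasis E n`, for the Lebesgue measure normalised on `e` — the computation "a form
supported in a single chart is integrated through `(φ⁻¹)^* ω`" (Lee (2013), Prop. 16.4/16.5 and
proof of Thm. 16.11). It is assembled from the tree's `exists_ofChart_eq_smul` (`ψ • β` is an
extension by zero `MForm.ofChart p η`), `MForm.integral_ofChart_smul` (integral of a chart bump
form) and `MForm.inChart_ofChart_of_mem` (recovering `η` on the target). With a partition of
unity subordinate to finitely many oriented charts this computes `∫_M` chart by chart
(additivity, `MForm.integral_add_holds`).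

Everything is proved; no definitions, no named facts.

## References

* J. M. Lee, *Introduction to Smooth Manifolds*, 2nd ed., GTM 218 (2013), Prop. 16.4,
  Prop. 16.5, Thm. 16.11. [LeeSmoothManifolds2013]
-/

noncomputable section

open scoped Manifold ContDiff Topology
open Set Function Module MeasureTheory Filter
open Literature.Geometry.Kaehler Literature.NumberTheory.Transcendental

namespace Literature.Geometry.Manifold

variable {E : Type*} [NormedAddCommGroup E] [NormedSpace ℝ E] [FiniteDimensional ℝ E]
  {n : ℕ} [Fact (finrank ℝ E = n)]
  {H : Type*} [TopologicalSpace H] {I : ModelWithCorners ℝ E H}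
  {M : Type*} [TopologicalSpace M] [ChartedSpace H M] [IsManifold I ∞ M] [I.Boundaryless]
  [MeasurableSpace E] [BorelSpace E] [T2Space M] [CompactSpace M]

omit [FiniteDimensional ℝ E] [Fact (finrank ℝ E = n)] [IsManifold I ∞ M] [I.Boundaryless]
  [MeasurableSpace E] [BorelSpace E] [T2Space M] [CompactSpace M] in
/-- The chart representative of `ψ • β` on the reference frame is `ψ ∘ φ⁻¹` times that of `β`.
[folklore] -/
theorem inChart_smul_fun_apply (ψ : M → ℝ) (β : MForm I M ℝ n) (p : M) (y : E) (v : Fin n → E) :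
    (ψ • β).inChart p y v = ψ ((extChartAt I p).symm y) * β.inChart p y v := by
  rw [MForm.inChart_apply, MForm.inChart_apply, Pi.smul_apply', ContinuousAlternatingMap.smul_apply,
    smul_eq_mul]

/-- **The integral of a top form supported in one oriented chart is the chart integral.** On a
closed manifold with orientation family `o`, if the chart at `p` has constant sign `ε` on
`B ⊆ target`, `ψ` is smooth with compact support in the chart source and
`extChartAt I p '' tsupport ψ ⊆ B`, then for every smooth top form `β`,
`∫_M ψ • β = ε ∫_{target} ψ (φ⁻¹ y) · β̂_p(y)(e) dλ_e` with `e = modelBasis E n` the reference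
frame and `λ_e` its Lebesgue measure (Lee (2013), Prop. 16.5 and proof of Thm. 16.11: a form
supported in a single chart is integrated through the chart). [cite: LeeSmoothManifolds2013, Prop. 16.5] -/
theorem integral_smul_eq_mul_setIntegral_inChart
    (o : (x : M) → Orientation ℝ (TangentSpace I x) (Fin n)) {p : M} {B : Set E} {ε : ℝ}
    (hBt : B ⊆ (extChartAt I p).target) (hsign : ∀ y ∈ B, chartSign o p y = ε)
    {ψ : M → ℝ} (hψ : ContMDiff I 𝓘(ℝ) ∞ ψ) (hψc : HasCompactSupport ψ)
    (hψs : tsupport ψ ⊆ (extChartAt I p).source) (hψB : extChartAt I p '' tsupport ψ ⊆ B)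
    {β : MForm I M ℝ n} (hβ : IsSmoothForm β) :
    (ψ • β).integral o = ε * ∫ y in (extChartAt I p).target,
      ψ ((extChartAt I p).symm y) * β.inChart p y (modelBasis E n) ∂(modelBasis E n).addHaar := by
  set e := modelBasis E n with he
  set D := basisDetL e with hDdef
  have hD : D e = 1 := basisDetL_self e
  obtain ⟨η, hηs, hηc, hηK, hηeq⟩ := exists_ofChart_eq_smul p hψ hψc hψs hβ
  have hηt : tsupport η ⊆ (extChartAt I p).target := hηK.trans (hψB.trans hBt)
  -- `η = g • D` with `g = η(e)`
  set g : E → ℝ := fun y ↦ η y e with hg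
  have hgD : η = fun y ↦ g y • D := funext fun y ↦
    ContinuousAlternatingMap.eq_apply_basis_smul e (η y) D hD
  have hgcont : Continuous g := (continuous_eval_const (⇑e : Fin n → E)).comp hηs.continuous
  have hgsupp : tsupport g ⊆ tsupport η := by
    refine closure_mono fun y hy ↦ ?_
    rw [mem_support] at hy ⊢
    contrapose! hy
    change η y e = 0
    rw [hy, ContinuousAlternatingMap.coe_zero, Pi.zero_apply]
  have hgc : HasCompactSupport g :=
    IsCompact.of_isClosed_subset hηc (isClosed_tsupport _) hgsupp
  -- the value of `g` on the target: `ψ (φ⁻¹ y) · β̂(y)(e)`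
  have hgval : ∀ y ∈ (extChartAt I p).target,
      g y = ψ ((extChartAt I p).symm y) * β.inChart p y e := by
    intro y hy
    have hx : (extChartAt I p).symm y ∈ (extChartAt I p).source := (extChartAt I p).map_target hy
    have hy' : extChartAt I p ((extChartAt I p).symm y) = y := (extChartAt I p).right_inv hy
    have h1 := MForm.inChart_ofChart_of_mem (I := I) p η hx hx
    rw [hy', hηeq] at h1
    have h2 := congrArg (fun w : E [⋀^Fin n]→L[ℝ] ℝ ↦ w e) h1
    simp only [ContinuousAlternatingMap.compContinuousLinearMap_apply] at h2
    have h3 : (⇑(tangentCoordChange I p p ((extChartAt I p).symm y)) ∘ ⇑e) = e :=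
      funext fun i ↦ tangentCoordChange_self hx
    rw [h3, inChart_smul_fun_apply] at h2
    exact h2.symm
  rw [← hηeq, hgD, MForm.integral_ofChart_smul o p hD hgcont hgc (hgsupp.trans hηt)
      (fun y hy ↦ hsign y (hψB (hηK (hgsupp hy))))]
  congr 1
  rw [← setIntegral_eq_integral_of_forall_compl_eq_zero (s := (extChartAt I p).target)
      (fun y hy ↦ image_eq_zero_of_notMem_tsupport fun h ↦ hy ((hgsupp.trans hηt) h))]
  exact setIntegral_congr_fun (isOpen_extChartAt_target p).measurableSet fun y hy ↦ hgval y hy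

/-! ### Changing the reference frame and the Lebesgue normalisation -/

/-- **Lebesgue measures of two bases**: `λ_e = |det_b e|⁻¹ · λ_b` (the Haar measure normalised on
the parallelepiped of `e`, versus that of `b`; `λ_b (parallelepiped e) = |det_b e|`, Mathlib's
`Basis.addHaar_parallelepiped`). [folklore] -/
theorem basis_addHaar_eq_abs_det_inv_smul {V : Type*} [NormedAddCommGroup V]
    [NormedSpace ℝ V] [FiniteDimensional ℝ V] [MeasurableSpace V] [BorelSpace V]
    {ι : Type*} [Fintype ι] [DecidableEq ι] (b e : Basis ι ℝ V) :
    e.addHaar = ENNReal.ofReal |b.det e|⁻¹ • b.addHaar := by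
  have hinv : e.det b = (b.det e)⁻¹ :=
    eq_inv_of_mul_eq_one_right (by rw [Basis.det_mul_det, Basis.det_self])
  conv_lhs => rw [MeasureTheory.Measure.addHaarMeasure_unique e.addHaar b.parallelepiped]
  rw [Basis.addHaar_def b, Basis.coe_parallelepiped, MeasureTheory.Measure.addHaar_parallelepiped,
    hinv, abs_inv]

/-- A continuous top form on two frames: `w(v) = w(b) · det_b(v)`. [folklore] -/
theorem continuousAlternatingMap_apply_eq_apply_basis_mul_det {V : Type*}
    [NormedAddCommGroup V] [NormedSpace ℝ V] {ι : Type*} [Fintype ι] [DecidableEq ι]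
    (b : Basis ι ℝ V) (w : V [⋀^ι]→L[ℝ] ℝ) (v : ι → V) : w v = w b * b.det v := by
  have h := congrArg (fun f : V [⋀^ι]→ₗ[ℝ] ℝ ↦ f v)
    (AlternatingMap.eq_smul_basis_det b w.toAlternatingMap)
  simp only [AlternatingMap.smul_apply, smul_eq_mul] at h
  exact h

/-- `d · |d|⁻¹ = sign d`. [folklore] -/
theorem mul_abs_inv_eq_real_sign (d : ℝ) : d * |d|⁻¹ = Real.sign d := by
  rcases lt_trichotomy d 0 with h | rfl | h
  · rw [Real.sign_of_neg h, abs_of_neg h, inv_neg, mul_neg, mul_inv_cancel₀ h.ne]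
  · simp [Real.sign_zero]
  · rw [Real.sign_of_pos h, abs_of_pos h, mul_inv_cancel₀ h.ne']

/-- **The single-chart integral in an arbitrary frame.** Same as
`integral_smul_eq_mul_setIntegral_inChart`, with the chart integral written for ANY basis `b` of
the model space (frame `b`, Lebesgue measure `λ_b` normalised on `b`): the change of frame costs
the factor `sign (det_b e)`, `e = modelBasis E n` (`β̂(e) = β̂(b) det_b e` and
`λ_e = |det_b e|⁻¹ λ_b`). [cite: LeeSmoothManifolds2013, Prop. 16.5] -/
theorem integral_smul_eq_mul_setIntegral_inChart_basis
    (o : (x : M) → Orientation ℝ (TangentSpace I x) (Fin n)) {p : M} {B : Set E} {ε : ℝ}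
    (hBt : B ⊆ (extChartAt I p).target) (hsign : ∀ y ∈ B, chartSign o p y = ε)
    {ψ : M → ℝ} (hψ : ContMDiff I 𝓘(ℝ) ∞ ψ) (hψc : HasCompactSupport ψ)
    (hψs : tsupport ψ ⊆ (extChartAt I p).source) (hψB : extChartAt I p '' tsupport ψ ⊆ B)
    {β : MForm I M ℝ n} (hβ : IsSmoothForm β) (b : Basis (Fin n) ℝ E) :
    (ψ • β).integral o = ε * Real.sign (b.det (modelBasis E n)) *
      ∫ y in (extChartAt I p).target,
        ψ ((extChartAt I p).symm y) * β.inChart p y b ∂b.addHaar := by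
  set e := modelBasis E n with he
  rw [integral_smul_eq_mul_setIntegral_inChart o hBt hsign hψ hψc hψs hψB hβ,
    basis_addHaar_eq_abs_det_inv_smul b e, Measure.restrict_smul, integral_smul_measure,
    ENNReal.toReal_ofReal (inv_nonneg.2 (abs_nonneg _)), mul_assoc]
  congr 1
  have h1 : ∀ y, ψ ((extChartAt I p).symm y) * β.inChart p y e =
      b.det e * (ψ ((extChartAt I p).symm y) * β.inChart p y b) := fun y ↦ by
    rw [continuousAlternatingMap_apply_eq_apply_basis_mul_det b (β.inChart p y) e]
    ring
  rw [setIntegral_congr_fun (isOpen_extChartAt_target p).measurableSet (fun y _ ↦ h1 y),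
    integral_const_mul, smul_eq_mul, ← mul_assoc, mul_comm (|b.det e|⁻¹) (b.det e),
    mul_abs_inv_eq_real_sign]

end Literature.Geometry.Manifold

end
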